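import Summits.Ventures.HodgeRepro2.T6MainM2Stmt

/-!
# T6MainM2 — THE M2-FINAL COMPOSITE: the closed theorem inhabiting `HCCMOfPublished₂` (README §10.4 M2)

Cell pub-hodge-repro2, Tier 6 (README §10). Built by seat t6-p6 (gen 11) on the lead's word (STATUS l. 12079 (3) «BUILD IT»;
the SHAPE RULING l. 12137); the lead's file, filed by t6-lead (g6). The statement is `HCCMOfPublished₂` (T6MainM2Stmt: the nine M1 displays, the N
side's parameters `Choice Adm surf τ₁ e e_mem` per Betti datum and corner product, the automorphic datum `M` over the
host-shadow period datum `NDatum.ofHostShadow …`, and the 170 binders of `periodInputN_of_published₇` lifted under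
`∀ Bd hB K [..] C`); the proof is `hccm_of_published_M1C` (T6MainM1C, M1 (host) DECLARED, STATUS l. 12121) applied to the
(N) binder `Hyp.PeriodNHostC` discharged per Betti datum and corner product: v7's engine `periodInputN_of_published₇` at
`M Bd hB K C` gives a choice `c` with `Hyp.PeriodN ((NDatum.ofHostShadow …).shadow c)`, which IS `Hyp.PeriodN (shadowOf …
(surf c).S (surf c).hS (surf c).f …)` by the definition of `NDatum.ofHostShadow` (defeq — `ofHostShadow_shadow` is `rfl`),
so `⟨(surf c).S, (surf c).hS, (surf c).f, hPN⟩` is the (N) witness. M2-final = M1 ∘ v7, every v7 binder by name. No new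
display; no `sorry`; standard axioms (trio, guard-checked). §8(d): uses an L-value-free non-vanishing device: NO.
-/

noncomputable section

open CategoryTheory
open HostAPI.Carriers.AlgebraicGeometry.Motives HostAPI.Carriers.AlgebraicGeometry.HodgeTheory

namespace Summit.Ventures.HodgeRepro2.T6

open Summit.Ventures.HodgeRepro2.T6.Host Summit.Ventures.HodgeRepro2.T6.WeilInst
  Summit.Ventures.HodgeRepro2.T6.WeilAssembly Summit.Ventures.HodgeRepro2.T6.A1HostBridge
  Summit.Ventures.HodgeRepro2.T6.HostCoeff
open N5Skeleton
open scoped InnerProductSpace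

/-- **THE M2-FINAL COMPOSITE**: `HCCMOfPublished₂` holds — `HostAPI.HCCM.Statement` from the published displays and the M2
datum, by `hccm_of_published_M1C` applied to the v7 discharge of `Hyp.PeriodNHostC` on the host-shadow period datum. -/
theorem hccmOfPublished₂_holds : HCCMOfPublished₂ :=
  fun h0 hS4 hBd h17 hD hLefD hT21 hProd hPt _Choice _Adm surf _τ₁ _e _e_mem M hex hfr h₁₁₁ hm he hAdm R hR0
    hR1 hR2 hs hst hRbr hO hsimp hPX hPeqX hPY hPeqY hσX hσ hN1H hN1L hN1A hN1B _ιA LA hHDA hHDbrA hKCA hSeamA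
    hAdjA hKLA hΘτA hEA hOA hInclA hTauA hDecA hFA hCA hAvgA hEqA hSpanA hCOA hIndA hTSA _ιB LB hHDB hHDbrB
    hKCB hSeamB hAdjB hKLB hΘτB hEB hOB hInclB hTauB hDecB hFB hCB hAvgB hEqB hSpanB hCOB hIndB hTSB XA XB hxA
    hxB hISA hposA hnmA hFLA hMA hGIA hEL₁A hA2f₂A hEL₂A hA2f₃A hEL₃A hB₁A hB₂A hB₃A hGQTA hLRA hpadicA hI₁eA
    hI₂eA hI₁A hI₂A hP₁A hP₂A PlA InA SpA LQA KdA hLR7A hBumpA hHaA hRoA hMinA hB451A hRaoA hdichA hκ'A hRA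
    TdA hRIPA hU116A hZsA hZnA hISB hposB hnmB hFLB hMB hGIB hEL₁B hA2f₂B hEL₂B hA2f₃B hEL₃B hB₁B hB₂B hB₃B
    hGQTB hLRB hpadicB hI₁eB hI₂eB hI₁B hI₂B hP₁B hP₂B PlB InB SpB LQB KdB hLR7B hBumpB hHaB hRoB hMinB hB451B
    hRaoB hdichB hκ'B hRB TdB hRIPB hU116B hZsB hZnB hT R5 hR5 hL dict hA hB hsol hre hc5 =>
  hccm_of_published_M1C h0 hS4 hBd h17 hD hLefD hT21 hProd hPt (fun Bd hBc K _ _ _ _ C =>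
    let ⟨c, _, hPN⟩ := periodInputN_of_published₇ (M Bd hBc K C)
      (hex Bd hBc K C) (hfr Bd hBc K C) (h₁₁₁ Bd hBc K C) (hm Bd hBc K C) (he Bd hBc K C) (hAdm Bd hBc K C) (R
        Bd hBc K C) (hR0 Bd hBc K C) (hR1 Bd hBc K C) (hR2 Bd hBc K C) (hs Bd hBc K C) (hst Bd hBc K C) (hRbr
        Bd hBc K C) (hO Bd hBc K C) (hsimp Bd hBc K C) (hPX Bd hBc K C) (hPeqX Bd hBc K C) (hPY Bd hBc K C)
        (hPeqY Bd hBc K C) (hσX Bd hBc K C) (hσ Bd hBc K C) (hN1H Bd hBc K C) (hN1L Bd hBc K C) (hN1A Bd hBc K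
        C) (hN1B Bd hBc K C) (LA Bd hBc K C) (hHDA Bd hBc K C) (hHDbrA Bd hBc K C) (hKCA Bd hBc K C) (hSeamA
        Bd hBc K C) (hAdjA Bd hBc K C) (hKLA Bd hBc K C) (hΘτA Bd hBc K C) (hEA Bd hBc K C) (hOA Bd hBc K C)
        (hInclA Bd hBc K C) (hTauA Bd hBc K C) (hDecA Bd hBc K C) (hFA Bd hBc K C) (hCA Bd hBc K C) (hAvgA Bd
        hBc K C) (hEqA Bd hBc K C) (hSpanA Bd hBc K C) (hCOA Bd hBc K C) (hIndA Bd hBc K C) (hTSA Bd hBc K C)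
        (LB Bd hBc K C) (hHDB Bd hBc K C) (hHDbrB Bd hBc K C) (hKCB Bd hBc K C) (hSeamB Bd hBc K C) (hAdjB Bd
        hBc K C) (hKLB Bd hBc K C) (hΘτB Bd hBc K C) (hEB Bd hBc K C) (hOB Bd hBc K C) (hInclB Bd hBc K C)
        (hTauB Bd hBc K C) (hDecB Bd hBc K C) (hFB Bd hBc K C) (hCB Bd hBc K C) (hAvgB Bd hBc K C) (hEqB Bd
        hBc K C) (hSpanB Bd hBc K C) (hCOB Bd hBc K C) (hIndB Bd hBc K C) (hTSB Bd hBc K C) (XA Bd hBc K C)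
        (XB Bd hBc K C) (hxA Bd hBc K C) (hxB Bd hBc K C) (hISA Bd hBc K C) (hposA Bd hBc K C) (hnmA Bd hBc K
        C) (hFLA Bd hBc K C) (hMA Bd hBc K C) (hGIA Bd hBc K C) (hEL₁A Bd hBc K C) (hA2f₂A Bd hBc K C) (hEL₂A
        Bd hBc K C) (hA2f₃A Bd hBc K C) (hEL₃A Bd hBc K C) (hB₁A Bd hBc K C) (hB₂A Bd hBc K C) (hB₃A Bd hBc K
        C) (hGQTA Bd hBc K C) (hLRA Bd hBc K C) (hpadicA Bd hBc K C) (hI₁eA Bd hBc K C) (hI₂eA Bd hBc K C)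
        (hI₁A Bd hBc K C) (hI₂A Bd hBc K C) (hP₁A Bd hBc K C) (hP₂A Bd hBc K C) (PlA Bd hBc K C) (InA Bd hBc K
        C) (SpA Bd hBc K C) (LQA Bd hBc K C) (KdA Bd hBc K C) (hLR7A Bd hBc K C) (hBumpA Bd hBc K C) (hHaA Bd
        hBc K C) (hRoA Bd hBc K C) (hMinA Bd hBc K C) (hB451A Bd hBc K C) (hRaoA Bd hBc K C) (hdichA Bd hBc K
        C) (hκ'A Bd hBc K C) (hRA Bd hBc K C) (TdA Bd hBc K C) (hRIPA Bd hBc K C) (hU116A Bd hBc K C) (hZsA Bd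
        hBc K C) (hZnA Bd hBc K C) (hISB Bd hBc K C) (hposB Bd hBc K C) (hnmB Bd hBc K C) (hFLB Bd hBc K C)
        (hMB Bd hBc K C) (hGIB Bd hBc K C) (hEL₁B Bd hBc K C) (hA2f₂B Bd hBc K C) (hEL₂B Bd hBc K C) (hA2f₃B
        Bd hBc K C) (hEL₃B Bd hBc K C) (hB₁B Bd hBc K C) (hB₂B Bd hBc K C) (hB₃B Bd hBc K C) (hGQTB Bd hBc K
        C) (hLRB Bd hBc K C) (hpadicB Bd hBc K C) (hI₁eB Bd hBc K C) (hI₂eB Bd hBc K C) (hI₁B Bd hBc K C)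
        (hI₂B Bd hBc K C) (hP₁B Bd hBc K C) (hP₂B Bd hBc K C) (PlB Bd hBc K C) (InB Bd hBc K C) (SpB Bd hBc K
        C) (LQB Bd hBc K C) (KdB Bd hBc K C) (hLR7B Bd hBc K C) (hBumpB Bd hBc K C) (hHaB Bd hBc K C) (hRoB Bd
        hBc K C) (hMinB Bd hBc K C) (hB451B Bd hBc K C) (hRaoB Bd hBc K C) (hdichB Bd hBc K C) (hκ'B Bd hBc K
        C) (hRB Bd hBc K C) (TdB Bd hBc K C) (hRIPB Bd hBc K C) (hU116B Bd hBc K C) (hZsB Bd hBc K C) (hZnB Bd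
        hBc K C) (hT Bd hBc K C) (R5 Bd hBc K C) (hR5 Bd hBc K C) (hL Bd hBc K C) (dict Bd hBc K C) (hA Bd hBc
        K C) (hB Bd hBc K C) (hsol Bd hBc K C) (hre Bd hBc K C) (hc5 Bd hBc K C)
    ⟨(surf Bd hBc K C c).S, (surf Bd hBc K C c).hS, (surf Bd hBc K C c).f, hPN⟩)

end Summit.Ventures.HodgeRepro2.T6

end
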